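import Literature.Probability.LatticeModels.IntersectionClusteringBound
import Literature.Probability.LatticeModels.BoxTwoPointTransfer
import HarnessLib

/-!
# Lattice preliminaries for the intersection property (Aizenman–Duminil-Copin 2021, Lemma 6.2): the two-point inputs and the passage box graph ↔ `ℤ⁴`

Topic `Literature/Probability/LatticeModels`. Theorems only; no definition and no named fact is
introduced. The proof of Lemma 6.2 of M. Aizenman, H. Duminil-Copin, Ann. of Math. **194** (2021),
arXiv:1912.07973 [AizenmanDuminilCopinAnnals2021] (p. 21: "Restricting our attention to the case of
`y` belonging to a regular scale enables us to use properties P1 and P2 of the regularity assumption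
… For the bound on the probabilities of the events `F₁,…,F₄` … the bounds in (4.7) and (4.8) follow
readily from the Infrared Bound (5.1)") is carried out in finite volume ("we work with finite `Λ`
and then take the limit", App. A.2) on the induced graphs `boxGraph (box 4 L)` of the tree. This
file collects the dictionary between the two languages:

* `exists_infraredBound_twoPointFree_four` — the infrared bound in the form used by
  `TwoPointSphereSums`: one constant `A ≥ 0` with `⟨σ₀σ_x⟩^∅_β ≤ A/‖x‖²_∞` for all `0 ≤ β ≤ β_c(4)`,
  `x ≠ 0` (the tree's `twoPointFree_criticalBeta_upper_holds` and monotonicity in `β`);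
* `bubbleDiagram_growth_twoPointFree` — Lemma 6.3 (`aizenmanDuminilCopin_bubbleDiagram_growth_holds`,
  stated for the DLR states) for the free two-point function `twoPointFree 4 β`;
* `toReal_ecurrentSum_pair_eq_mul_isingTwoPoint`, `isingTwoPoint_box_pos` — on `boxGraph Λ` with the
  constant coupling `β`, `Z[{a}Δ{b}] = Z[∅] · ⟨σ_aσ_b⟩^∅_Λ` (the hypothesis `hg` of
  `Current.intersectionProperty_of_twoPoint_bounds`) and `⟨σ_aσ_b⟩^∅_{Λ_L} > 0` for `β > 0`;
* `sum_distSphere_le_sum_sphere`, `sum_distSphere_sphere_le`, `sum_latAnnulus_eq_sum_ann`,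
  `sum_latAnnulus_latAnnulus_eq` — re-indexing sums over the vertices of `boxGraph (box 4 L)` at
  prescribed distances from `u` by the lattice spheres `sphere 4 r` and annuli `ann 4 m M` of the
  differences `v - u`;
* `mem_ann_of_central_regular` — for `y` with `n ≤ ‖y-u‖ ≤ 2n` and `w` with `‖w-u‖ ≤ b`, `2b < ‖y-u‖`,
  the differences `y-w`, `w-y` (and `y-u`, `u-y`) lie in the annulus `Ann(n/2, 4n)` of Def. 5.11, where
  the regularity property P1 compares the two-point function.

## References

* M. Aizenman, H. Duminil-Copin, Ann. of Math. 194 (2021), arXiv:1912.07973, §6.1, Lemma 6.2 and its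
  proof, Lemma 6.3 (p. 21); Def. 5.11 (p. 20); App. A.2 [AizenmanDuminilCopinAnnals2021].
-/

noncomputable section

open MeasureTheory Finset Filter Topology
open scoped symmDiff ENNReal

namespace Literature.Probability.LatticeModels

/-! ### The two-point inputs on `ℤ⁴` -/

/-- `⟨σ₀σ_x⟩^∅_β ≤ 1` on `ℤ⁴` (`β ≥ 0`). [folklore] -/
theorem twoPointFree_four_le_one {β : ℝ} (hβ : 0 ≤ β) (x : Site 4) : twoPointFree 4 β x ≤ 1 :=
  twoPointFree_le_one hasBoxLimit_isingCorr_free_holds hβ x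

/-- **The infrared bound on `ℤ⁴` below and at `β_c`**, in the form `⟨σ₀σ_x⟩^∅_β ≤ A/‖x‖²_∞` for all
`0 ≤ β ≤ β_c(4)` and `x ≠ 0` (Aizenman–Duminil-Copin 2021, (5.1): "`⟨σ₀σ_x⟩_β ≤ C/|x|^{d-2}`"; the tree's
`twoPointFree_criticalBeta_upper_holds` at `β_c` and Griffiths' monotonicity in `β`).
[cite: AizenmanDuminilCopinAnnals2021, arXiv:1912.07973 eq. (5.1) (the Infrared Bound, p. 16)] -/
theorem exists_infraredBound_twoPointFree_four :
    ∃ A : ℝ, 0 ≤ A ∧ ∀ β : ℝ, 0 ≤ β → β ≤ criticalBeta 4 →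
      ∀ x : Site 4, x ≠ 0 → twoPointFree 4 β x ≤ A / (Site.supNorm x : ℝ) ^ 2 := by
  obtain ⟨C₀, hC₀⟩ := twoPointFree_criticalBeta_upper_holds (d := 4) (by norm_num)
  have hlim : hasBoxLimit_isingCorr_free 4 := hasBoxLimit_isingCorr_free_holds
  have hβmono : isingCorr_free_mono_beta (d := 4) := isingCorr_free_mono_beta_holds
  refine ⟨max C₀ 0, le_max_right _ _, fun β hβ hβc x hx0 => ?_⟩
  have hn : (1 : ℝ) ≤ Site.supNorm x := by
    have : Site.supNorm x ≠ 0 := fun h => hx0 (Site.supNorm_eq_zero_iff.1 h)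
    exact_mod_cast Nat.one_le_iff_ne_zero.2 this
  have hexp : (‖x‖ : ℝ) ^ (-(((4 : ℕ) : ℝ) - 2)) = ((Site.supNorm x : ℝ) ^ 2)⁻¹ := by
    rw [Site.norm_eq_supNorm, show (-(((4 : ℕ) : ℝ) - 2)) = -(2 : ℝ) by norm_num,
      Real.rpow_neg (by positivity), Real.rpow_two]
  calc twoPointFree 4 β x ≤ twoPointFree 4 (criticalBeta 4) x := twoPointFree_mono_beta hβmono hlim hβ hβc x
    _ ≤ C₀ * (‖x‖ : ℝ) ^ (-(((4 : ℕ) : ℝ) - 2)) := hC₀ x hx0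
    _ = C₀ / (Site.supNorm x : ℝ) ^ 2 := by rw [hexp, div_eq_mul_inv]
    _ ≤ max C₀ 0 / (Site.supNorm x : ℝ) ^ 2 := div_le_div_of_nonneg_right (le_max_left _ _) (by positivity)

/-- **Lemma 6.3 for the free two-point function** (Aizenman–Duminil-Copin 2021, Lemma 6.3, in the
proof-supported form of the tree's `aizenmanDuminilCopin_bubbleDiagram_growth`): there is `C > 0` with
`B_L ≤ (1 + C(1 + log(L/ℓ))/log ℓ) B_ℓ` for `0 ≤ β ≤ β_c(4)`, integers `2 ≤ ℓ ≤ L` in the window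
`L ≤ ξ(β)`, `B_n = bubbleDiagram (twoPointFree 4 β) n` (the free state is a DLR state with two-point
function `twoPointFree`). [cite: AizenmanDuminilCopinAnnals2021, arXiv:1912.07973 Lemma 6.3 (p. 21)] -/
theorem bubbleDiagram_growth_twoPointFree :
    ∃ C : ℝ, 0 < C ∧ ∀ (β : ℝ) (ℓ L : ℕ), 0 ≤ β → β ≤ criticalBeta 4 → 2 ≤ ℓ → ℓ ≤ L →
      (β = criticalBeta 4 ∨ (0 < β ∧ (L : ℝ) * invCorrLength (twoPointPlus 4 β) ≤ 1)) →
      bubbleDiagram (twoPointFree 4 β) L ≤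
        (1 + C * (1 + Real.log ((L : ℝ) / ℓ)) / Real.log ℓ) * bubbleDiagram (twoPointFree 4 β) ℓ := by
  obtain ⟨C, hC, h⟩ := aizenmanDuminilCopin_bubbleDiagram_growth_holds
  refine ⟨C, hC, fun β ℓ L hβ hβc hℓ hℓL hwin => ?_⟩
  obtain ⟨μ, hμ, -⟩ := exists_freeMeasure_holds 4 (β := β) 0 hβ le_rfl
  have hS : twoPoint μ spinAt 0 = twoPointFree 4 β := funext fun v => twoPoint_zero_eq_twoPointFree hβ hβc hμ v
  have := h β ℓ L hβ hβc hℓ hℓL hwin μ hμ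
  rwa [hS] at this

/-! ### The box graph: two-point functions as current-sum ratios -/

/-- **`Z_Λ[{a}Δ{b}] = Z_Λ[∅] · ⟨σ_aσ_b⟩^∅_{Λ;β}`** on the induced graph of `Λ ⊆ ℤ^d` with the constant
coupling `β ≥ 0` (the random-current representation of the free two-point function; the hypothesis
`hg` of `Current.intersectionProperty_of_twoPoint_bounds`). [cite: AizenmanDuminilCopinAnnals2021, arXiv:1912.07973 §3.2, eq. (3.5) (⟨σ_xσ_y⟩ = Z[xy]/Z[∅])] -/
theorem toReal_ecurrentSum_pair_eq_mul_isingTwoPoint {d : ℕ} (Λ : Finset (Site d)) {β : ℝ} (hβ : 0 ≤ β)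
    (a b : ↥Λ) :
    (ecurrentSum (fun _ : (boxGraph Λ).edgeFinset => β) ({a} ∆ {b})).toReal =
      (ecurrentSum (fun _ : (boxGraph Λ).edgeFinset => β) ∅).toReal *
        isingTwoPoint (zdGraph d) Λ β 0 .free (a : Site d) b := by
  have hK : ∀ e : (boxGraph Λ).edgeFinset, 0 ≤ (fun _ : (boxGraph Λ).edgeFinset => β) e := fun _ => hβ
  rw [isingTwoPoint_free_eq_boxGraph, isingTwoPoint_free_eq_currentSum_div_holds, currentSum_eq_wcurrentSum,
    currentSum_eq_wcurrentSum, toReal_ecurrentSum hK, toReal_ecurrentSum hK,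
    mul_div_cancel₀ _ (wcurrentSum_empty_pos hK).ne']

/-- **Positivity of the free two-point function of a box** for `β > 0`: `⟨σ_aσ_b⟩^∅_{Λ_L;β} > 0` for
`a, b ∈ Λ_L` (a path inside the box carries a current). [cite: DuminilCopin2016, §2.1] -/
theorem isingTwoPoint_box_pos {d L : ℕ} {β : ℝ} (hβ : 0 < β) (a b : ↥(box d L)) :
    0 < isingTwoPoint (zdGraph d) (box d L) β 0 .free (a : Site d) b := by
  rw [isingTwoPoint_free_eq_boxGraph, isingTwoPoint_free_eq_currentSum_div_holds]
  have hreach : (boxGraph (box d L)).Reachable a b := boxGraph_box_reachable (d := d) (L := L) a.2 b.2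
  have h1 : 0 < currentSum (boxGraph (box d L)) β ({a} ∆ {b}) := Current.currentSum_pair_pos hβ hreach
  have h2 : 0 < currentSum (boxGraph (box d L)) β ∅ := by
    rw [currentSum_eq_wcurrentSum]; exact wcurrentSum_empty_pos fun _ => hβ.le
  exact div_pos h1 h2

/-! ### Re-indexing sums over the box graph by lattice spheres and annuli of differences -/

/-- A vertex at distance `r` from `u` has difference on the sphere of radius `r`. [folklore] -/
theorem sub_mem_sphere_of_dist_eq {u v : Site 4} {r : ℕ} (h : dist u v = r) : v - u ∈ sphere 4 r := by
  rw [mem_sphere, Site.supNorm_sub_comm]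
  rw [Site.dist_eq_supNorm] at h
  exact_mod_cast h

/-- **Sphere re-indexing**: a non-negative function of the difference `v - u`, summed over the vertices
of `boxGraph (box 4 L)` at distance `r` from `u`, is at most its sum over the lattice sphere `∂Λ_r`.
[folklore] -/
theorem sum_distSphere_le_sum_sphere {L : ℕ} (u : Site 4) (r : ℕ) (F : Site 4 → ℝ) (hF : ∀ x, 0 ≤ F x)
    (Sr : Finset ↥(box 4 L)) (hSr : ∀ v ∈ Sr, dist u (v : Site 4) = r) :
    ∑ v ∈ Sr, F ((v : Site 4) - u) ≤ ∑ x ∈ sphere 4 r, F x := by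
  classical
  calc ∑ v ∈ Sr, F ((v : Site 4) - u) = ∑ x ∈ Sr.image (fun v : ↥(box 4 L) => (v : Site 4) - u), F x := by
        rw [Finset.sum_image]
        intro v _ w _ h
        exact Subtype.ext (sub_left_injective h)
    _ ≤ ∑ x ∈ sphere 4 r, F x := by
        refine Finset.sum_le_sum_of_subset_of_nonneg ?_ fun x _ _ => hF x
        intro x hx
        rw [Finset.mem_image] at hx
        obtain ⟨v, hv, rfl⟩ := hx
        exact sub_mem_sphere_of_dist_eq (hSr v hv)

/-- **Double sphere re-indexing** for a function of the two differences, non-negative. [folklore] -/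
theorem sum_distSphere_sphere_le {L : ℕ} (u : Site 4) (r s : ℕ) (F : Site 4 → Site 4 → ℝ)
    (hF : ∀ x z, 0 ≤ F x z) (Sr Ss : Finset ↥(box 4 L)) (hSr : ∀ v ∈ Sr, dist u (v : Site 4) = r)
    (hSs : ∀ w ∈ Ss, dist u (w : Site 4) = s) :
    ∑ v ∈ Sr, ∑ w ∈ Ss, F ((v : Site 4) - u) ((w : Site 4) - u) ≤ ∑ x ∈ sphere 4 r, ∑ z ∈ sphere 4 s, F x z :=
  calc ∑ v ∈ Sr, ∑ w ∈ Ss, F ((v : Site 4) - u) ((w : Site 4) - u)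
      ≤ ∑ v ∈ Sr, ∑ z ∈ sphere 4 s, F ((v : Site 4) - u) z :=
        Finset.sum_le_sum fun v _ => sum_distSphere_le_sum_sphere u s (F ((v : Site 4) - u)) (hF _) Ss hSs
    _ ≤ ∑ x ∈ sphere 4 r, ∑ z ∈ sphere 4 s, F x z :=
        sum_distSphere_le_sum_sphere u r (fun x => ∑ z ∈ sphere 4 s, F x z)
          (fun x => Finset.sum_nonneg fun z _ => hF x z) Sr hSr

/-- **Annulus re-indexing (a bijection)**: when the ball `u + Λ_M` lies in the box, the vertices of
`latAnnulus (box 4 L) u m M` correspond to the lattice annulus `Ann(m, M)` of differences. [folklore] -/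
theorem sum_latAnnulus_eq_sum_ann {L : ℕ} {u : Site 4} {m M : ℕ}
    (hfull : ∀ x : Site 4, Site.supNorm x ≤ M → u + x ∈ box 4 L) (F : Site 4 → ℝ) :
    ∑ v ∈ latAnnulus (box 4 L) u m M, F ((v : Site 4) - u) = ∑ x ∈ ann 4 m M, F x := by
  classical
  refine Finset.sum_bij' (fun v _ => (v : Site 4) - u)
    (fun x hx => ⟨u + x, hfull x (mem_ann.1 hx).2⟩) ?_ ?_ ?_ ?_ ?_
  · intro v hv
    unfold latAnnulus at hv
    rw [Finset.mem_filter] at hv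
    obtain ⟨-, h1, h2⟩ := hv
    rw [Site.dist_eq_supNorm, Site.supNorm_sub_comm] at h1 h2
    rw [mem_ann]
    constructor
    · exact_mod_cast h1
    · exact_mod_cast h2
  · intro x hx
    rw [mem_ann] at hx
    unfold latAnnulus
    rw [Finset.mem_filter]
    refine ⟨Finset.mem_univ _, ?_, ?_⟩
    · rw [Site.dist_eq_supNorm, show u - (u + x) = -x by abel, Site.supNorm_neg]
      exact_mod_cast hx.1
    · rw [Site.dist_eq_supNorm, show u - (u + x) = -x by abel, Site.supNorm_neg]
      exact_mod_cast hx.2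
  · intro v _
    apply Subtype.ext
    simp
  · intro x _
    simp
  · intro v _
    rfl

/-- **Double annulus re-indexing** for a function of the two differences. [folklore] -/
theorem sum_latAnnulus_latAnnulus_eq {L : ℕ} {u : Site 4} {m M : ℕ}
    (hfull : ∀ x : Site 4, Site.supNorm x ≤ M → u + x ∈ box 4 L) (F : Site 4 → Site 4 → ℝ) :
    ∑ v ∈ latAnnulus (box 4 L) u m M, ∑ w ∈ latAnnulus (box 4 L) u m M, F ((v : Site 4) - u) ((w : Site 4) - u) =
      ∑ x ∈ ann 4 m M, ∑ z ∈ ann 4 m M, F x z := by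
  rw [← sum_latAnnulus_eq_sum_ann hfull (fun x => ∑ z ∈ ann 4 m M, F x z)]
  refine Finset.sum_congr rfl fun v _ => ?_
  exact sum_latAnnulus_eq_sum_ann hfull (F ((v : Site 4) - u))

/-! ### The regular annulus around a central vertex -/

/-- **The differences seen from a central regular vertex lie in the regular annulus.** If
`n ≤ ‖y-u‖_∞ ≤ 2n`, `‖w-u‖_∞ ≤ b` and `2b < ‖y-u‖_∞`, then `y - w` and `w - y` lie in
`Ann(n/2, 4n)` (the annulus of Def. 5.11 at scale `n`), and so do `y - u` and `u - y`. [cite: AizenmanDuminilCopinAnnals2021, arXiv:1912.07973 Def. 5.11 and the proof of Lemma 6.2 ("y … in a regular scale", p. 21)] -/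
theorem mem_ann_of_central_regular {n b : ℕ} {y u w : Site 4} (hn : n ≤ Site.supNorm (y - u))
    (hn2 : Site.supNorm (y - u) ≤ 2 * n) (hb : 2 * b < Site.supNorm (y - u)) (hw : Site.supNorm (w - u) ≤ b) :
    y - w ∈ ann 4 (n / 2) (4 * n) ∧ w - y ∈ ann 4 (n / 2) (4 * n) ∧
      y - u ∈ ann 4 (n / 2) (4 * n) ∧ u - y ∈ ann 4 (n / 2) (4 * n) := by
  have h1 : (Site.supNorm (y - u) : ℝ) - Site.supNorm (w - u) ≤ Site.supNorm (y - w) := by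
    rw [← Site.norm_eq_supNorm, ← Site.norm_eq_supNorm, ← Site.norm_eq_supNorm]
    have := norm_sub_norm_le (y - u) (w - u)
    rwa [sub_sub_sub_cancel_right] at this
  have h2 : (Site.supNorm (y - w) : ℝ) ≤ Site.supNorm (y - u) + Site.supNorm (w - u) := by
    rw [← Site.norm_eq_supNorm, ← Site.norm_eq_supNorm, ← Site.norm_eq_supNorm]
    have := norm_sub_le (y - u) (w - u)
    rwa [sub_sub_sub_cancel_right] at this
  have h1' : Site.supNorm (y - u) ≤ Site.supNorm (y - w) + Site.supNorm (w - u) := by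
    have : (Site.supNorm (y - u) : ℝ) ≤ Site.supNorm (y - w) + Site.supNorm (w - u) := by linarith
    exact_mod_cast this
  have h2' : Site.supNorm (y - w) ≤ Site.supNorm (y - u) + Site.supNorm (w - u) := by exact_mod_cast h2
  have hyw : y - w ∈ ann 4 (n / 2) (4 * n) := by
    rw [mem_ann]; omega
  have hyu : y - u ∈ ann 4 (n / 2) (4 * n) := by
    rw [mem_ann]; omega
  refine ⟨hyw, ?_, hyu, ?_⟩
  · rw [show w - y = -(y - w) by abel, mem_ann, Site.supNorm_neg]; exact mem_ann.1 hyw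
  · rw [show u - y = -(y - u) by abel, mem_ann, Site.supNorm_neg]; exact mem_ann.1 hyu

end Literature.Probability.LatticeModels
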